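import Summits.AtomisticToContinuum.BoseEinsteinCondensation.Theorems.CorrectorClosure.Negative.InsertionResidueTorusPlaneWaves
import Literature.MathematicalPhysics.QuantumManyBody.PeriodicBoseGasImpurity

/-!
# Negative lemmas for crux `CorrectorClosure` (stmt-AtomisticToContinuum-12058), II-b:
the normalised one-excitation state on the torus

Supports stmt-AtomisticToContinuum-12058 (route `BECInsertionCorrector`). The derivative and the
(constant) kinetic density `M|b|²|k|²` of `a + b N_k 1`, the normalised periodic trial state
`affineState = (a + b N_k 1)/‖·‖` (`(a,b) ≠ 0`, `M ≥ 1`, `k = 2πn/L ≠ 0`), its free energy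
`⟨Ψ,-ΔΨ⟩ = M|b|²|k|²/(|a|²+M|b|²) ≤ |k|²` (`periodicEnergy_zero_affineState_le`) and its insertion
overlap with `φ₀ ⊗ Θ` as the linear form `c L³ (a w₁ + b w₂)`, `w₁ = ∫ conj Θ`,
`w₂ = ∫ conj Θ · N_k 1` (`overlap_affineState`).
-/

noncomputable section

open MeasureTheory Filter Metric WithLp
open scoped ENNReal NNReal ComplexConjugate BigOperators

namespace Summit.AtomisticToContinuum.BoseEinsteinCondensation.Theorems.CorrectorClosure.Negative

open Literature.MathematicalPhysics.QuantumManyBody.BoseGas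
open Summit.AtomisticToContinuum.BoseEinsteinCondensation.Theses.BECInsertionCorrector

section CellNIntegrals

variable {M : ℕ} {L : ℝ}

/-! ### Derivative and kinetic energy of the one-excitation function -/

/-- `D(N_k 1)(X) = ∑ⱼ De_n(xⱼ) ∘ projⱼ`. [folklore] -/
theorem hasFDerivAt_planeWaveSum (L : ℝ) (n : Fin 3 → ℤ) (X : Config M) :
    HasFDerivAt (planeWaveSum (M := M) L n)
      (∑ j, (fderiv ℝ (cellWave L n) (X j)).comp (ContinuousLinearMap.proj j)) X := by
  have h : ∀ j : Fin M, HasFDerivAt (fun Y : Config M => cellWave L n (Y j))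
      ((fderiv ℝ (cellWave L n) (X j)).comp (ContinuousLinearMap.proj j)) X := fun j => by
    have := ((hasFDerivAt_cellWave L n (X j)).differentiableAt.hasFDerivAt).comp X
      (hasFDerivAt_apply (𝕜 := ℝ) j X)
    exact this
  show HasFDerivAt (fun Y : Config M => ∑ j, cellWave L n (Y j)) _ X
  exact HasFDerivAt.fun_sum (u := Finset.univ) fun j _ => h j

/-- `∂_{i,c}(N_k 1)(X) = (2πi n_c / L) e_n(xᵢ)`. [folklore] -/
theorem fderiv_planeWaveSum_apply_single (L : ℝ) (n : Fin 3 → ℤ) (X : Config M) (i : Fin M)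
    (c : Fin 3) :
    fderiv ℝ (planeWaveSum (M := M) L n) X (Pi.single i (EuclideanSpace.single c 1)) =
      (2 * Real.pi * Complex.I * (n c) / L) * cellWave L n (X i) := by
  rw [(hasFDerivAt_planeWaveSum L n X).fderiv, FunLike.coe_sum, Finset.sum_apply,
    Finset.sum_eq_single i]
  · rw [ContinuousLinearMap.comp_apply, ContinuousLinearMap.proj_apply, Pi.single_eq_same,
      fderiv_cellWave_apply_single]
  · intro j _ hji
    rw [ContinuousLinearMap.comp_apply, ContinuousLinearMap.proj_apply, Pi.single_eq_of_ne hji,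
      map_zero]
  · intro h; exact (h (Finset.mem_univ i)).elim

/-- The squared lattice momentum `|2πn/L|² = ∑_c (2π n_c/L)²`. [folklore] -/
def momSq (L : ℝ) (n : Fin 3 → ℤ) : ℝ := ∑ c : Fin 3, (2 * Real.pi * (n c) / L) ^ 2

/-- `momSq ≥ 0`. [folklore] -/
theorem momSq_nonneg (L : ℝ) (n : Fin 3 → ℤ) : 0 ≤ momSq L n :=
  Finset.sum_nonneg fun _ _ => sq_nonneg _

/-- `|2π e₀/L|² = (2π/L)²`. [folklore] -/
theorem momSq_e0 (L : ℝ) : momSq L e0 = (2 * Real.pi / L) ^ 2 := by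
  simp [momSq, e0, Fin.sum_univ_three]

/-- **Kinetic density of an affine one-excitation function** `G = a + b N_k 1`:
`|∇G|² ≡ M |b|² |2πn/L|²` (a constant). [folklore] -/
theorem kineticDensity_affine (L : ℝ) (n : Fin 3 → ℤ) (a b : ℂ) (X : Config M) :
    kineticDensity (fun Y : Config M => a + b * planeWaveSum L n Y) X =
      ENNReal.ofReal (M * (‖b‖ ^ 2 * momSq L n)) := by
  have hG : HasFDerivAt (fun Y : Config M => a + b * planeWaveSum L n Y)
      (b • ∑ j, (fderiv ℝ (cellWave L n) (X j)).comp (ContinuousLinearMap.proj j)) X :=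
    ((hasFDerivAt_planeWaveSum L n X).const_mul b).const_add a
  unfold kineticDensity
  rw [hG.fderiv]
  have hterm : ∀ (i : Fin M) (c : Fin 3),
      ((‖(b • ∑ j, (fderiv ℝ (cellWave L n) (X j)).comp (ContinuousLinearMap.proj j))
          (Pi.single i (EuclideanSpace.single c 1))‖₊ : ℝ≥0∞) ^ 2) =
        ENNReal.ofReal (‖b‖ ^ 2 * (2 * Real.pi * (n c) / L) ^ 2) := by
    intro i c
    rw [FunLike.coe_smul, Pi.smul_apply, ← (hasFDerivAt_planeWaveSum L n X).fderiv,
      fderiv_planeWaveSum_apply_single, coe_nnnorm_sq_eq_ofReal, smul_eq_mul]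
    congr 1
    have hr : (2 * ↑Real.pi * Complex.I * ↑(n c) / ↑L : ℂ) =
        ((2 * Real.pi * (n c) / L : ℝ) : ℂ) * Complex.I := by
      push_cast; ring
    rw [hr, norm_mul, norm_mul, norm_mul, Complex.norm_real, Complex.norm_I, norm_cellWave, mul_one,
      mul_one, Real.norm_eq_abs, mul_pow, sq_abs]
  simp_rw [hterm]
  rw [Finset.sum_comm]
  simp_rw [Finset.sum_const, Finset.card_univ, Fintype.card_fin, nsmul_eq_mul]
  rw [← Finset.mul_sum, ← ENNReal.ofReal_sum_of_nonneg (fun c _ => by positivity),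
    ← Finset.mul_sum, ← ENNReal.ofReal_natCast, ← ENNReal.ofReal_mul (by positivity)]
  rfl

/-! ### The normalised one-excitation trial state and its free energy -/

/-- The affine one-excitation function is `C¹`. [folklore] -/
theorem contDiff_affine (L : ℝ) (n : Fin 3 → ℤ) (a b : ℂ) :
    ContDiff ℝ 1 fun Y : Config M => a + b * planeWaveSum L n Y :=
  contDiff_const.add (contDiff_const.mul (contDiff_planeWaveSum L n))

/-- It is periodic. [folklore] -/
theorem affine_periodic (hL : L ≠ 0) (n : Fin 3 → ℤ) (a b : ℂ) (X : Config M) (i : Fin M)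
    (c : Fin 3) :
    (fun Y : Config M => a + b * planeWaveSum L n Y) (X + Pi.single i (EuclideanSpace.single c L)) =
      (fun Y : Config M => a + b * planeWaveSum L n Y) X := by
  simp only [planeWaveSum_periodic hL]

/-- It is Bose-symmetric. [folklore] -/
theorem affine_symm (L : ℝ) (n : Fin 3 → ℤ) (a b : ℂ) (σ : Equiv.Perm (Fin M)) (X : Config M) :
    (fun Y : Config M => a + b * planeWaveSum L n Y) (X ∘ σ) =
      (fun Y : Config M => a + b * planeWaveSum L n Y) X := by
  simp only [planeWaveSum_symm]

/-- Its norm on the cell is finite. [folklore] -/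
theorem lintegral_affine_ne_top (hL : 0 < L) {n : Fin 3 → ℤ} (hn : n ≠ 0) (a b : ℂ) :
    ∫⁻ X in cellN M L, (‖a + b * planeWaveSum L n X‖₊ : ℝ≥0∞) ^ 2 ≠ ⊤ := by
  rw [lintegral_cellN_nnnorm_sq_affine hL hn]
  exact ENNReal.ofReal_ne_top

/-- Its norm on the cell is non-zero as soon as `(a, b) ≠ 0` and `M ≥ 1`. [folklore] -/
theorem lintegral_affine_ne_zero (hL : 0 < L) (hM : 0 < M) {n : Fin 3 → ℤ} (hn : n ≠ 0) {a b : ℂ}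
    (hab : a ≠ 0 ∨ b ≠ 0) :
    ∫⁻ X in cellN M L, (‖a + b * planeWaveSum L n X‖₊ : ℝ≥0∞) ^ 2 ≠ 0 := by
  rw [lintegral_cellN_nnnorm_sq_affine hL hn, ne_eq, ENNReal.ofReal_eq_zero, not_le]
  have hV : 0 < (L ^ 3) ^ M := by positivity
  have hM' : (0 : ℝ) < M := by exact_mod_cast hM
  rcases hab with ha | hb
  · have : 0 < ‖a‖ := norm_pos_iff.2 ha
    positivity
  · have : 0 < ‖b‖ := norm_pos_iff.2 hb
    positivity

/-- **The normalised one-excitation state** `(a + b N_k 1)/‖·‖`, `(a,b) ≠ 0`, `M ≥ 1`, `n ≠ 0`.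
[folklore] -/
def affineState (hL : 0 < L) (hM : 0 < M) {n : Fin 3 → ℤ} (hn : n ≠ 0) {a b : ℂ}
    (hab : a ≠ 0 ∨ b ≠ 0) : PeriodicTrialState M L :=
  PeriodicTrialState.ofFun (fun Y : Config M => a + b * planeWaveSum L n Y) (contDiff_affine L n a b)
    (affine_periodic hL.ne' n a b) (affine_symm L n a b) (lintegral_affine_ne_zero hL hM hn hab)
    (lintegral_affine_ne_top hL hn a b)

/-- **Free energy of a normalised state** `ψ/‖ψ‖`: `⟨·,-Δ·⟩ = ‖ψ‖⁻² ∫ |∇ψ|²`. [folklore] -/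
theorem periodicEnergy_zero_ofFun (ψ : Config M → ℂ) (hC : ContDiff ℝ 1 ψ)
    (hper : ∀ (X : Config M) (i : Fin M) (a : Fin 3),
      ψ (X + Pi.single i (EuclideanSpace.single a L)) = ψ X)
    (hsymm : ∀ (σ : Equiv.Perm (Fin M)) (X : Config M), ψ (X ∘ σ) = ψ X)
    (h0 : ∫⁻ X in cellN M L, ((‖ψ X‖₊ : ℝ≥0∞)) ^ 2 ≠ 0)
    (htop : ∫⁻ X in cellN M L, ((‖ψ X‖₊ : ℝ≥0∞)) ^ 2 ≠ ⊤) :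
    periodicEnergy 0 (PeriodicTrialState.ofFun ψ hC hper hsymm h0 htop) =
      (∫⁻ X in cellN M L, ((‖ψ X‖₊ : ℝ≥0∞)) ^ 2)⁻¹ * ∫⁻ X in cellN M L, kineticDensity ψ X := by
  set I := ∫⁻ X in cellN M L, ((‖ψ X‖₊ : ℝ≥0∞)) ^ 2 with hI
  have hIpos : 0 < I.toReal := ENNReal.toReal_pos h0 htop
  have hfun : (PeriodicTrialState.ofFun ψ hC hper hsymm h0 htop).ψ =
      fun X => ((Real.sqrt I.toReal)⁻¹ : ℂ) * ψ X := rfl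
  unfold periodicEnergy
  have hint0 : ∀ X : Config M, periodicInteraction 0 L X = 0 := fun X => by
    simp [periodicInteraction, periodizedPotential_zero]
  simp_rw [hint0, zero_mul, add_zero]
  rw [hfun]
  simp_rw [kineticDensity_const_mul_complex]
  rw [lintegral_const_mul' _ _ (ENNReal.pow_ne_top ENNReal.coe_ne_top)]
  congr 1
  rw [coe_nnnorm_sq_eq_ofReal, norm_inv, Complex.norm_real,
    Real.norm_of_nonneg (Real.sqrt_nonneg _), inv_pow, Real.sq_sqrt hIpos.le,
    ENNReal.ofReal_inv_of_pos hIpos, ENNReal.ofReal_toReal htop]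

/-- **The one-excitation state costs at most one quantum**: `⟨Ψ, -ΔΨ⟩ ≤ |2πn/L|²` for
`Ψ = (a + b N_k 1)/‖·‖` (exactly `M|b|²|k|²/(|a|² + M|b|²)`). [folklore] -/
theorem periodicEnergy_zero_affineState_le (hL : 0 < L) (hM : 0 < M) {n : Fin 3 → ℤ} (hn : n ≠ 0)
    {a b : ℂ} (hab : a ≠ 0 ∨ b ≠ 0) :
    periodicEnergy 0 (affineState hL hM hn hab) ≤ ENNReal.ofReal (momSq L n) := by
  unfold affineState
  rw [periodicEnergy_zero_ofFun]
  simp_rw [kineticDensity_affine]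
  rw [setLIntegral_const, volume_cellN, lintegral_cellN_nnnorm_sq_affine hL hn]
  have hV : ((ENNReal.ofReal L) ^ 3) ^ M = ENNReal.ofReal ((L ^ 3) ^ M) := by
    rw [← ENNReal.ofReal_pow hL.le, ← ENNReal.ofReal_pow (by positivity)]
  rw [hV, ← ENNReal.ofReal_mul
    (mul_nonneg (Nat.cast_nonneg _) (mul_nonneg (sq_nonneg _) (momSq_nonneg L n)))]
  have hVpos : 0 < (L ^ 3) ^ M := by positivity
  have hM' : (0 : ℝ) < M := by exact_mod_cast hM
  have hI : 0 < (‖a‖ ^ 2 + M * ‖b‖ ^ 2) * (L ^ 3) ^ M := by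
    rcases hab with ha | hb
    · have : 0 < ‖a‖ := norm_pos_iff.2 ha
      positivity
    · have : 0 < ‖b‖ := norm_pos_iff.2 hb
      positivity
  rw [mul_comm, ← div_eq_mul_inv,
    ENNReal.div_le_iff (ENNReal.ofReal_pos.2 hI).ne' ENNReal.ofReal_ne_top,
    ← ENNReal.ofReal_mul (momSq_nonneg L n)]
  apply ENNReal.ofReal_le_ofReal
  have hp := momSq_nonneg L n
  have h1 : 0 ≤ momSq L n * ‖a‖ ^ 2 * (L ^ 3) ^ M := by positivity
  have key : momSq L n * ((‖a‖ ^ 2 + M * ‖b‖ ^ 2) * (L ^ 3) ^ M) -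
      M * (‖b‖ ^ 2 * momSq L n) * (L ^ 3) ^ M = momSq L n * ‖a‖ ^ 2 * (L ^ 3) ^ M := by ring
  linarith

/-! ### The insertion overlap of the one-excitation state -/

/-- `N_k 1 (x, Y) = e_n(x) + N_k 1 (Y)`. [folklore] -/
theorem planeWaveSum_vecCons (L : ℝ) (n : Fin 3 → ℤ) (x : Space) (Y : Config M) :
    planeWaveSum L n (Matrix.vecCons x Y : Config (M + 1)) = cellWave L n x + planeWaveSum L n Y := by
  unfold planeWaveSum
  rw [Fin.sum_univ_succ, Matrix.cons_val_zero]
  simp only [Matrix.cons_val_succ]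

/-- The tagged zero-mode integral of the affine function: `∫_cell (a + bN_k 1)(x,Y)dx = L³(a + b N_k 1(Y))`.
[folklore] -/
theorem setIntegral_cell_affine_vecCons (hL : 0 < L) {n : Fin 3 → ℤ} (hn : n ≠ 0) (a b : ℂ)
    (Y : Config M) :
    ∫ x in cell L, (a + b * planeWaveSum L n (Matrix.vecCons x Y : Config (M + 1))) =
      ((L ^ 3 : ℝ) : ℂ) * (a + b * planeWaveSum L n Y) := by
  simp_rw [planeWaveSum_vecCons, mul_add]
  have i1 : IntegrableOn (fun _ : Space => a) (cell L) volume := integrableOn_cell continuous_const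
  have i2 : IntegrableOn (fun x : Space => b * cellWave L n x) (cell L) volume :=
    integrableOn_cell (continuous_const.mul (contDiff_cellWave L n).continuous)
  have i3 : IntegrableOn (fun _ : Space => b * planeWaveSum L n Y) (cell L) volume :=
    integrableOn_cell continuous_const
  have i23 : IntegrableOn (fun x : Space => b * cellWave L n x + b * planeWaveSum L n Y) (cell L) volume :=
    i2.add i3
  rw [integral_add i1 i23, integral_add i2 i3, integral_const_mul, integral_cell_cellWave_eq_zero hL hn,
    setIntegral_cell_const hL.le, setIntegral_cell_const hL.le]
  ring

/-- **The insertion overlap of the affine state is the linear form `c L³ (a w₁ + b w₂)`** with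
`w₁ = ∫ conj Θ`, `w₂ = ∫ conj Θ · N_k 1`. [folklore] -/
theorem overlap_affineState {N : ℕ} (hL : 0 < L) {n : Fin 3 → ℤ} (hn : n ≠ 0) {a b : ℂ}
    (hab : a ≠ 0 ∨ b ≠ 0) (Θ : Config N → ℂ) (hΘ : Continuous Θ) :
    ∫ Y in cellN N L, conj (Θ Y) *
        ∫ x in cell L, (affineState (M := N + 1) hL (Nat.succ_pos N) hn hab).ψ (Matrix.vecCons x Y) =
      ((Real.sqrt (∫⁻ X in cellN (N + 1) L,
          ((‖a + b * planeWaveSum L n X‖₊ : ℝ≥0∞)) ^ 2).toReal)⁻¹ : ℂ) * ((L ^ 3 : ℝ) : ℂ) *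
        (a * (∫ Y in cellN N L, conj (Θ Y)) +
          b * ∫ Y in cellN N L, conj (Θ Y) * planeWaveSum L n Y) := by
  unfold affineState
  simp only [PeriodicTrialState.ofFun_apply]
  set C : ℂ := ((Real.sqrt (∫⁻ X in cellN (N + 1) L,
          ((‖a + b * planeWaveSum L n X‖₊ : ℝ≥0∞)) ^ 2).toReal)⁻¹ : ℂ) with hC
  have inner : ∀ Y : Config N,
      (∫ x in cell L, C * (a + b * planeWaveSum L n (Matrix.vecCons x Y : Config (N + 1)))) =
        C * (((L ^ 3 : ℝ) : ℂ) * (a + b * planeWaveSum L n Y)) := fun Y => by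
    rw [integral_const_mul, setIntegral_cell_affine_vecCons hL hn]
  simp_rw [inner]
  have hF : Continuous (planeWaveSum (M := N) L n) := (contDiff_planeWaveSum L n).continuous
  have i1 : IntegrableOn (fun Y : Config N => conj (Θ Y) * a) (cellN N L) volume :=
    integrableOn_cellN (hΘ.star.mul continuous_const) L
  have i2 : IntegrableOn (fun Y : Config N => conj (Θ Y) * (b * planeWaveSum L n Y)) (cellN N L) volume :=
    integrableOn_cellN (hΘ.star.mul (continuous_const.mul hF)) L
  have hexp : ∀ Y : Config N, conj (Θ Y) * (C * (((L ^ 3 : ℝ) : ℂ) * (a + b * planeWaveSum L n Y))) =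
      (C * ((L ^ 3 : ℝ) : ℂ)) * (conj (Θ Y) * a + conj (Θ Y) * (b * planeWaveSum L n Y)) := by
    intro Y; ring
  simp_rw [hexp]
  have e1 : ∫ Y in cellN N L, conj (Θ Y) * a = (∫ Y in cellN N L, conj (Θ Y)) * a :=
    integral_mul_const a _
  have e2 : ∫ Y in cellN N L, conj (Θ Y) * (b * planeWaveSum L n Y) =
      b * ∫ Y in cellN N L, conj (Θ Y) * planeWaveSum L n Y := by
    have : (fun Y : Config N => conj (Θ Y) * (b * planeWaveSum L n Y)) =
        fun Y => b * (conj (Θ Y) * planeWaveSum L n Y) := by funext Y; ring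
    rw [this, integral_const_mul]
  rw [integral_const_mul (C * ((L ^ 3 : ℝ) : ℂ)), integral_add i1 i2, e1, e2]
  ring

end CellNIntegrals

end Summit.AtomisticToContinuum.BoseEinsteinCondensation.Theorems.CorrectorClosure.Negative

end
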